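import Summits.QuantumAdvantage.QuantumAdvantage.Theorems.CubicForrelationNearExactIsExactTwelveTypeOShape2932

/-!
# Crux `CubicForrelation.NearExactIsExact` (stmt-QuantumAdvantage-14043) — n = 12, type O with base set `1024` (zero excess, `Φ = 29/32`):
  the PARTNER is NOT type O (Walsh inversion at the affine centre `c₁` gives `u_f(c₁) = 4(−1)^{g(c₁)}`, even)

Certificate seat `b2b-cforr-cert` (gen 22).  HONEST FRAMING: a kernel-checked lemma (standard axioms, no `decide`) about cubic Boolean pairs on
12 bits — the first cut into the zero-excess configuration `#E = 1024` of the boundary rung `29/32` (`to21_typeO_E1024_zero_excess`): of the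
three possible types of the partner `f` (type O / level 5 / level `≥ 6`) the type-O one is excluded.  The level-5 and level-`≥ 6` partners
(which need the character sums of the weight-`1024` cubic support `E`) are NOT treated here.  NO new value of `θ₁₂`.  NOT summit progress.

* `to22_typeO_E1024_partner_centre`: cubic `f, g`, `W_g = 16u`, some `u` odd, `#E = 1024`, `Φ ≥ 29/32`, `W_f = 16u_f`: there is a point
  `y` (the centre `c₁` of the affine digit `d₁`, `(−1)^{d₁(x)} = (−1)^{b₁}(−1)^{c₁·x}`) with `u_f(y) = 4(−1)^{g(y)}`.  Proof: the wild function
  vanishes (`to21_typeO_E1024_zero_excess`), and the partner identity (`to18_typeO_partner_identity`) at `y = c₁` reads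
  `64u_f(c₁) = 256(−1)^{g(c₁)} − (−1)^{b₁}(4096 − 4·#E) = 256(−1)^{g(c₁)}`.
* `to22_typeO_E1024_partner_not_typeO`: hence `u_f` is even somewhere, so (the parity of `u_f` being constant for a cubic, `tc_const_of_deg_zero`)
  `u_f` is even everywhere: the partner is at level `≥ 5`.
* `to22_typeO_E1024_typeO_partner_false`: a type-O × type-O pair with a base set of `1024` points does not exist at `Φ ≥ 29/32`.

References: Kasami–Tokura (1970); MacWilliams–Sloane (1977) Ch. 14–15; O'Donnell (2014) §1.4, §3.3.  Axioms: the standard three.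
-/

set_option linter.dupNamespace false -- D-0017: single-problem summit ⇒ `QuantumAdvantage.QuantumAdvantage` by design

noncomputable section

namespace Summit.QuantumAdvantage.QuantumAdvantage.Theorems.CubicForrelation.NearExactIsExact

open Finset
open Literature.Computability.QuantumComplexity
open Literature.Computability.QuantumComplexity.BuzetChailloux (bxor zeroVec bxor_bxor_cancel_left bxor_zeroVec zeroVec_bxor bxor_comm
  bxor_self twist_zeroVec_right twist_bxor_right)
open Literature.Computability.QuantumComplexity.DerivativeWalsh (W sum_W_sq)
open Literature.Computability.QuantumComplexity.Simon (twist_eq_one_or)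
open Summit.QuantumAdvantage.QuantumAdvantage.Theorems.NearExactIsExact.Negative (TypeOTwelve.typeO_of_exists_odd)

/-- **Base `1024`: the partner's spectrum at the centre.**  Cubic `f, g` on 12 bits, `W_g = 16u` with some `u(x)` odd, `#E = 1024`,
`Φ ≥ 29/32`, `W_f = 16u_f`: there is `y` with `u_f(y) = 4(−1)^{g(y)}`.  See the module docstring.  NOT summit progress. [this work] -/
theorem to22_typeO_E1024_partner_centre (f g : (Fin (6 + 6) → Bool) → Bool) (hg : IsDegLeFun 3 g)
    (u : (Fin (6 + 6) → Bool) → ℤ) (hu : ∀ x, W (fun y => signOf (g y)) x = (2 : ℝ) ^ 4 * (u x : ℝ))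
    (hodd : ∃ x, Odd (u x)) (hE : #(univ.filter fun x : Fin (6 + 6) → Bool => (Odd (u x / 2) ↔ Odd (u x / 2 / 2))) = 1024)
    (hΦ : (29 / 32 : ℝ) ≤ forrelation f g)
    (uf : (Fin (6 + 6) → Bool) → ℤ) (huf : ∀ y, W (fun x => signOf (f x)) y = (2 : ℝ) ^ 4 * (uf y : ℝ)) :
    ∃ y, uf y = 4 * sZ (g y) := by
  classical
  have hall : ∀ x, Odd (u x) := TypeOTwelve.typeO_of_exists_odd g u hg hu hodd
  have hu' : ∀ x, W (fun y => signOf (g y)) x = (2 : ℝ) ^ (2 * 2) * (u x : ℝ) := fun x => (hu x).trans (by norm_num)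
  have hd1 : IsDegLeFun 1 (fun x => decide (Odd (u x / 2))) := z2_digitOne 2 g u hg hu' hall
  obtain ⟨c₁, b₁, hcb⟩ := stub_affineForm (6 + 6) _ hd1
  set E := univ.filter (fun x : Fin (6 + 6) → Bool => (Odd (u x / 2) ↔ Odd (u x / 2 / 2))) with hEdef
  -- zero excess: the wild function vanishes
  obtain ⟨-, hτ, -⟩ := to21_typeO_E1024_zero_excess f g hg u hu hodd hE hΦ
  have hv : ∀ x, u x - 4 * sZ (f x) =
      sZ (decide (Odd (u x / 2))) * (1 - 4 * (if (Odd (u x / 2) ↔ Odd (u x / 2 / 2)) then 1 else 0)) + 8 * (fun _ => (0 : ℤ)) x := by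
    intro x; rw [hτ x]; ring
  -- the partner identity at the centre `c₁`
  have h := to18_typeO_partner_identity f g u hu (fun _ => 0) hv c₁ b₁ hcb uf huf c₁
  rw [← hEdef] at h
  have hz : bxor c₁ c₁ = (fun _ => false) := by funext i; simp [bxor]
  rw [if_pos hz] at h
  have hS : ∑ x ∈ E, twist x (bxor c₁ c₁) = 1024 := by
    rw [hz, show (fun _ : Fin (6 + 6) => false) = (zeroVec : Fin (6 + 6) → Bool) from rfl,
      sum_congr rfl fun x _ => twist_zeroVec_right x, sum_const]
    rw [show #E = 1024 from hE]; norm_num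
  rw [hS] at h
  have h0 : ∑ x, (((fun _ => (0 : ℤ)) x : ℤ) : ℝ) * twist x c₁ = 0 := sum_eq_zero fun x _ => by simp
  rw [h0] at h
  refine ⟨c₁, ?_⟩
  have e : ((2 : ℝ) ^ (6 + 6) - 4 * 1024) = 0 := by norm_num
  rw [e] at h
  have h' : ((uf c₁ : ℤ) : ℝ) = ((4 * sZ (g c₁) : ℤ) : ℝ) := by push_cast; rw [tp_sZ_cast]; linarith
  exact_mod_cast h'

/-- **Base `1024`: the partner is NOT type O.**  In the setting of `to22_typeO_E1024_partner_centre`, every `u_f(y)` is even (the parity of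
`u_f = W_f/16` is constant for a cubic `f`, and it is even at the centre).  NOT summit progress. [this work] -/
theorem to22_typeO_E1024_partner_not_typeO (f g : (Fin (6 + 6) → Bool) → Bool) (hf : IsDegLeFun 3 f) (hg : IsDegLeFun 3 g)
    (u : (Fin (6 + 6) → Bool) → ℤ) (hu : ∀ x, W (fun y => signOf (g y)) x = (2 : ℝ) ^ 4 * (u x : ℝ))
    (hodd : ∃ x, Odd (u x)) (hE : #(univ.filter fun x : Fin (6 + 6) → Bool => (Odd (u x / 2) ↔ Odd (u x / 2 / 2))) = 1024)
    (hΦ : (29 / 32 : ℝ) ≤ forrelation f g)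
    (uf : (Fin (6 + 6) → Bool) → ℤ) (huf : ∀ y, W (fun x => signOf (f x)) y = (2 : ℝ) ^ 4 * (uf y : ℝ)) :
    ∀ y, ¬ Odd (uf y) := by
  obtain ⟨y₀, hy₀⟩ := to22_typeO_E1024_partner_centre f g hg u hu hodd hE hΦ uf huf
  have hev : ¬ Odd (uf y₀) := by
    rw [hy₀, Int.not_odd_iff_even]
    exact ⟨2 * sZ (g y₀), by ring⟩
  intro y hy
  exact hev (TypeOTwelve.typeO_of_exists_odd f uf hf huf ⟨y, hy⟩ y₀)

/-- **No type-O × type-O pair with a base set of `1024` points at `Φ ≥ 29/32`** (12 bits): cubic `f, g`, `W_g = 16u` with some `u` odd and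
`#E = 1024`, `W_f = 16u_f` with some `u_f` odd, `Φ(f,g) ≥ 29/32` is impossible.  Finite-slice statement, NOT summit progress. [this work] -/
theorem to22_typeO_E1024_typeO_partner_false (f g : (Fin (6 + 6) → Bool) → Bool) (hf : IsDegLeFun 3 f) (hg : IsDegLeFun 3 g)
    (u : (Fin (6 + 6) → Bool) → ℤ) (hu : ∀ x, W (fun y => signOf (g y)) x = (2 : ℝ) ^ 4 * (u x : ℝ))
    (hodd : ∃ x, Odd (u x)) (hE : #(univ.filter fun x : Fin (6 + 6) → Bool => (Odd (u x / 2) ↔ Odd (u x / 2 / 2))) = 1024)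
    (uf : (Fin (6 + 6) → Bool) → ℤ) (huf : ∀ y, W (fun x => signOf (f x)) y = (2 : ℝ) ^ 4 * (uf y : ℝ)) (hoddf : ∃ y, Odd (uf y))
    (hΦ : (29 / 32 : ℝ) ≤ forrelation f g) : False := by
  obtain ⟨y, hy⟩ := hoddf
  exact to22_typeO_E1024_partner_not_typeO f g hf hg u hu hodd hE hΦ uf huf y hy

end Summit.QuantumAdvantage.QuantumAdvantage.Theorems.CubicForrelation.NearExactIsExact

end
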